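import Summits.Schanuel.Schanuel.Theorems.SoloInformedX193EntryFare

/-!
# X193 kernel line, file F6a: exceptional columns of one level — the deep-served columns

Solo seat `solo-Schanuel-informed`, X193 kernel programme (design note
`work/s213/X193-KERNEL-DESIGN.md`, Amendment A9; pen proof `work/s194/X193-pen.md` §6;
files F2 = `SoloInformedX193Service`, F5 = `SoloInformedX193EntryFare`,
F7a = `SoloInformedX193Lives`, F7e = `SoloInformedX193Count`).

Pen §6 shows that at a large level `n` all but `O(n^{σ-γ})` of the active columns
`1 ≤ k ≤ K ≤ n^σ` are served by a CHEAP capped main server (hypothesis (H6) =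
`SoloServiceData.cheapAssignable` of file F7a, refuted by the count of file F7e).  The
exceptional columns are of three kinds: LIQUID (no main server), DEEP-SERVED (served
by a main server for which the column is deep, i.e. its bank exceeds the cap) and
EXPENSIVE (assigned to a server of fare `> η`).  This file treats the deep-served kind
for an abstract service structure `D : SoloServiceData ι`, at one level, with an
explicit right-hand side:

* the two hypothesis families it consumes, recorded as `Set`-valued definitions to be
  proved in files F4 and F3 of the programme: `noCheapDepth` (NCD, pen §3: an active
  near-root bank of an alive piece, truncated at `n^ν`, is at most
  `C_P(n) + A₃ n² log (n+2)`) and `deepUnique` ((C), pen §2: a piece has at most one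
  deep column);
* the budget sums `Σ m_P C_P(n) ≤ 2 n^β n + b₁ n²`, `Σ m_P ≤ n`, `Σ m_P g_P² ≤ n²`
  (`sum_mult_cost_le`, `sum_mult_le_level`, `sum_mult_deg_sq_le`);
* main servers are near-root once `c₀ n < λ n^ν` (`nearRoot_of_main`, from (NRb));
* (T) `|Dp| · λ n^ν ≤ 2 n^β n + b₁ n² + A₃ n² log (n+2) · n` for any set `Dp` of
  deep-served columns (`deep_count`): NCD prices each server, (C) makes the servers of
  distinct columns distinct, and the budgets bound the sum over the servers.

The liquid kind is file F6b = `SoloInformedX193Liquid`; the expensive kind and the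
assembly of (H6) with its eventual absorptions are file F6c = `SoloInformedX193Assign`.
No sorries.
-/

namespace Summit.Schanuel.Schanuel.Theorems

open Finset

namespace SoloServiceData

variable {ι : Type*} (D : SoloServiceData ι)

/-! ### The two hypothesis families consumed by the deep-served count -/

/-- (NCD) no cheap depth at activating columns (pen §3, DESIGN §2; proved in file F4 from
(L1), (TW), (Bud), (FIN)): at every level `n ≥ n₃`, for every alive piece `P` and active
near-root column `1 ≤ k ≤ n^σ`, `min (d_P^k, n^ν) ≤ C_P(n) + A₃ n² log (n + 2)`. -/
def noCheapDepth (σ ν β A₃ : ℝ) (n₃ : ℕ) : Set (SoloServiceData ι) :=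
  {D | ∀ n : ℕ, n₃ ≤ n → ∀ P ∈ D.alive n, ∀ k : ℕ, 1 ≤ k → (k : ℝ) ≤ (n : ℝ) ^ σ →
    D.nearRoot P k = true →
    min (D.bank P k) ((n : ℝ) ^ ν) ≤
      D.cost β P n + A₃ * (n : ℝ) ^ 2 * Real.log ((n : ℝ) + 2)}

/-- (C) deep-column uniqueness (pen §2 (C); proved in file F3 from (PAIR) against the
twists, for `B` large in terms of `A₁`): at every level `n ≥ n₄` every piece has at most
one deep column (`deepCols`: active, near-root, bank above `cap_n`). -/
def deepUnique (σ B : ℝ) (n₄ : ℕ) : Set (SoloServiceData ι) :=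
  {D | ∀ n : ℕ, n₄ ≤ n → ∀ P : ι, (D.deepCols σ B P n).Subsingleton}

/-! ### Budget sums at one level -/

/-- (Bud) for the costs: `Σ_{P alive} m_P C_P(n) ≤ 2 n^β n + b₁ n²`. -/
theorem sum_mult_cost_le {β b₁ : ℝ} {n₀ : ℕ} (hB : D ∈ budgetLaw β b₁ n₀) {n : ℕ}
    (hn : n₀ ≤ n) :
    ∑ P ∈ D.alive n, (D.mult P n : ℝ) * D.cost β P n ≤
      2 * ((n : ℝ) ^ β * n) + b₁ * (n : ℝ) ^ 2 := by
  obtain ⟨h1, h2⟩ := hB n hn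
  have hsum : ∑ P ∈ D.alive n, (D.mult P n : ℝ) * D.cost β P n =
      (n : ℝ) ^ β * ∑ P ∈ D.alive n, (D.mult P n : ℝ) * D.deg P +
        (n : ℝ) * ∑ P ∈ D.alive n, (D.mult P n : ℝ) * D.logHt P := by
    rw [Finset.mul_sum, Finset.mul_sum, ← Finset.sum_add_distrib]
    refine Finset.sum_congr rfl fun P _ => ?_
    unfold cost
    ring
  rw [hsum]
  have hn0 : (0 : ℝ) ≤ n := by positivity
  have hnβ : (0 : ℝ) ≤ (n : ℝ) ^ β := by positivity
  nlinarith [mul_le_mul_of_nonneg_left h1 hnβ, mul_le_mul_of_nonneg_left h2 hn0]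

/-- (Bud) for the multiplicities: `Σ_{P alive} m_P ≤ n` (degrees are `≥ 1`). -/
theorem sum_mult_le_level {c₀ β b₁ : ℝ} {n₀ : ℕ} (hW : D ∈ wellFormed c₀)
    (hB : D ∈ budgetLaw β b₁ n₀) {n : ℕ} (hn : n₀ ≤ n) :
    ∑ P ∈ D.alive n, (D.mult P n : ℝ) ≤ n := by
  refine le_trans (Finset.sum_le_sum fun P _ => ?_) (hB n hn).1
  have hg : (1 : ℝ) ≤ D.deg P := by exact_mod_cast hW.1 P
  have hm : (0 : ℝ) ≤ D.mult P n := by positivity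
  nlinarith

/-- (Bud) for the squared degrees: `Σ_{P alive} m_P g_P² ≤ n²` (each `g_P ≤ n`). -/
theorem sum_mult_deg_sq_le {c₀ β b₁ : ℝ} {n₀ : ℕ} (hW : D ∈ wellFormed c₀)
    (hB : D ∈ budgetLaw β b₁ n₀) {n : ℕ} (hn : n₀ ≤ n) :
    ∑ P ∈ D.alive n, (D.mult P n : ℝ) * (D.deg P : ℝ) ^ 2 ≤ (n : ℝ) ^ 2 := by
  have h1 := (hB n hn).1
  have hle : ∑ P ∈ D.alive n, (D.mult P n : ℝ) * (D.deg P : ℝ) ^ 2 ≤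
      ∑ P ∈ D.alive n, (n : ℝ) * ((D.mult P n : ℝ) * D.deg P) := by
    refine Finset.sum_le_sum fun P hP => ?_
    have hg : (D.deg P : ℝ) ≤ n := D.deg_le_level hW hB hn hP
    have hm : (0 : ℝ) ≤ D.mult P n := by positivity
    have hg0 : (0 : ℝ) ≤ D.deg P := by positivity
    nlinarith [mul_nonneg hm hg0]
  rw [← Finset.mul_sum] at hle
  have hn0 : (0 : ℝ) ≤ n := by positivity
  nlinarith [mul_le_mul_of_nonneg_left h1 hn0]

/-! ### Main servers are near-root -/

/-- A main server (`λ n^ν ≤ m_P d_P^k`, `P` alive) is near-root at its column as soon as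
`c₀ n < λ n^ν`: otherwise (NRb) `d_P^k ≤ c₀ g_P` and `m_P g_P ≤ n` give
`m_P d_P^k ≤ c₀ n`. -/
theorem nearRoot_of_main {c₀ β b₁ : ℝ} {n₀ : ℕ} (hW : D ∈ wellFormed c₀) (hc₀ : 0 ≤ c₀)
    (hB : D ∈ budgetLaw β b₁ n₀) {P : ι} {n : ℕ} (hn : n₀ ≤ n) (hP : P ∈ D.alive n)
    {k : ℕ} {lam ν : ℝ} (hsup : lam * (n : ℝ) ^ ν ≤ D.mult P n * D.bank P k)
    (hsmall : c₀ * n < lam * (n : ℝ) ^ ν) : D.nearRoot P k = true := by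
  by_contra hNR
  have hNR' : D.nearRoot P k = false := by simpa using hNR
  have hd : D.bank P k ≤ c₀ * D.deg P := hW.2.2.2.1 P k hNR'
  have hmg : (D.mult P n : ℝ) * D.deg P ≤ n := D.mult_mul_deg_le_level hB hn hP
  have hm : (0 : ℝ) ≤ D.mult P n := by positivity
  have : (D.mult P n : ℝ) * D.bank P k ≤ c₀ * n :=
    calc (D.mult P n : ℝ) * D.bank P k ≤ D.mult P n * (c₀ * D.deg P) :=
          mul_le_mul_of_nonneg_left hd hm
      _ = c₀ * ((D.mult P n : ℝ) * D.deg P) := by ring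
      _ ≤ c₀ * n := mul_le_mul_of_nonneg_left hmg hc₀
  linarith

/-! ### (T) the deep-served columns -/

/-- (T) DEEP-SERVED columns (pen §6 (T)): if each column `k ∈ Dp ⊆ [1, K]`, `K ≤ n^σ`, is
served by a main server `srv k` (alive, `λ n^ν ≤ m d^k`) for which `k` is deep
(`cap_n < d^k`), then `|Dp| · λ n^ν ≤ 2 n^β n + b₁ n² + A₃ n² log (n+2) · n`.  By NCD,
`λ n^ν ≤ m (C(n) + A₃ n² log (n+2))` for each server; the servers are near-root, so `k`
is a deep column of `srv k` and distinct columns have distinct servers by (C); the budgets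
bound the sum over the servers. -/
theorem deep_count {c₀ β b₁ σ ν A₃ B lam : ℝ} {n₀ n₃ n₄ : ℕ} (hW : D ∈ wellFormed c₀)
    (hc₀ : 0 ≤ c₀) (hB : D ∈ budgetLaw β b₁ n₀) (hN : D ∈ noCheapDepth σ ν β A₃ n₃)
    (hU : D ∈ deepUnique σ B n₄) (hA₃ : 0 ≤ A₃) (hlam1 : lam ≤ 1) {n : ℕ} (hn₀ : n₀ ≤ n)
    (hn₃ : n₃ ≤ n) (hn₄ : n₄ ≤ n) (hsmall : c₀ * n < lam * (n : ℝ) ^ ν) {K : ℕ}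
    (hK : (K : ℝ) ≤ (n : ℝ) ^ σ) (Dp : Finset ℕ) (hDp : Dp ⊆ Finset.Icc 1 K) (srv : ℕ → ι)
    (hsrv : ∀ k ∈ Dp, srv k ∈ D.alive n ∧
      lam * (n : ℝ) ^ ν ≤ D.mult (srv k) n * D.bank (srv k) k ∧
      D.cap B (srv k) n < D.bank (srv k) k) :
    (Dp.card : ℝ) * (lam * (n : ℝ) ^ ν) ≤
      2 * ((n : ℝ) ^ β * n) + b₁ * (n : ℝ) ^ 2 +
        A₃ * (n : ℝ) ^ 2 * Real.log ((n : ℝ) + 2) * n := by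
  classical
  have hn0 : (0 : ℝ) ≤ n := by positivity
  have hlog : 0 ≤ Real.log ((n : ℝ) + 2) := Real.log_nonneg (by linarith)
  have hE : 0 ≤ A₃ * (n : ℝ) ^ 2 * Real.log ((n : ℝ) + 2) := by positivity
  have hMnn : ∀ P, 0 ≤ (D.mult P n : ℝ) *
      (D.cost β P n + A₃ * (n : ℝ) ^ 2 * Real.log ((n : ℝ) + 2)) := by
    intro P
    have hc : 0 ≤ D.cost β P n := le_trans (by positivity) (D.rpow_le_cost hW β P n)
    positivity
  have hcol : ∀ k ∈ Dp, lam * (n : ℝ) ^ ν ≤ (D.mult (srv k) n : ℝ) *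
      (D.cost β (srv k) n + A₃ * (n : ℝ) ^ 2 * Real.log ((n : ℝ) + 2)) := by
    intro k hk
    obtain ⟨hPa, hsup, -⟩ := hsrv k hk
    have hkI := Finset.mem_Icc.mp (hDp hk)
    have hkK : (k : ℝ) ≤ (n : ℝ) ^ σ := le_trans (by exact_mod_cast hkI.2) hK
    have hNR := D.nearRoot_of_main hW hc₀ hB hn₀ hPa hsup hsmall
    have hncd := hN n hn₃ (srv k) hPa k hkI.1 hkK hNR
    have hm1 : (1 : ℝ) ≤ D.mult (srv k) n := D.one_le_mult_of_alive hW hPa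
    have hmin : lam * (n : ℝ) ^ ν ≤
        D.mult (srv k) n * min (D.bank (srv k) k) ((n : ℝ) ^ ν) := by
      rcases le_total (D.bank (srv k) k) ((n : ℝ) ^ ν) with h | h
      · rw [min_eq_left h]; exact hsup
      · rw [min_eq_right h]
        have hnν : (0 : ℝ) ≤ (n : ℝ) ^ ν := by positivity
        nlinarith
    exact hmin.trans (mul_le_mul_of_nonneg_left hncd (by positivity))
  have hinj : Set.InjOn srv (Dp : Set ℕ) := by
    intro i hi j hj hij
    obtain ⟨hPi, hsupi, hcapi⟩ := hsrv i hi
    obtain ⟨hPj, hsupj, hcapj⟩ := hsrv j hj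
    have hiI := Finset.mem_Icc.mp (hDp hi)
    have hjI := Finset.mem_Icc.mp (hDp hj)
    have hNRi := D.nearRoot_of_main hW hc₀ hB hn₀ hPi hsupi hsmall
    have hNRj := D.nearRoot_of_main hW hc₀ hB hn₀ hPj hsupj hsmall
    have hdi : i ∈ D.deepCols σ B (srv i) n :=
      ⟨hiI.1, le_trans (by exact_mod_cast hiI.2) hK, hNRi, hcapi⟩
    have hdj : j ∈ D.deepCols σ B (srv i) n := by
      refine ⟨hjI.1, le_trans (by exact_mod_cast hjI.2) hK, ?_, ?_⟩
      · rw [hij]; exact hNRj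
      · rw [hij]; exact hcapj
    exact hU n hn₄ (srv i) hdi hdj
  have hsum : (Dp.card : ℝ) * (lam * (n : ℝ) ^ ν) ≤ ∑ k ∈ Dp, (D.mult (srv k) n : ℝ) *
      (D.cost β (srv k) n + A₃ * (n : ℝ) ^ 2 * Real.log ((n : ℝ) + 2)) := by
    rw [← nsmul_eq_mul, ← Finset.sum_const]
    exact Finset.sum_le_sum hcol
  have himg : ∑ k ∈ Dp, (D.mult (srv k) n : ℝ) *
      (D.cost β (srv k) n + A₃ * (n : ℝ) ^ 2 * Real.log ((n : ℝ) + 2)) =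
      ∑ P ∈ Dp.image srv, (D.mult P n : ℝ) *
        (D.cost β P n + A₃ * (n : ℝ) ^ 2 * Real.log ((n : ℝ) + 2)) :=
    (Finset.sum_image (f := fun P => (D.mult P n : ℝ) *
      (D.cost β P n + A₃ * (n : ℝ) ^ 2 * Real.log ((n : ℝ) + 2))) hinj).symm
  have hsub : Dp.image srv ⊆ D.alive n := by
    intro P hP
    obtain ⟨k, hk, rfl⟩ := Finset.mem_image.mp hP
    exact (hsrv k hk).1
  have htot : ∑ P ∈ Dp.image srv, (D.mult P n : ℝ) *
        (D.cost β P n + A₃ * (n : ℝ) ^ 2 * Real.log ((n : ℝ) + 2)) ≤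
      ∑ P ∈ D.alive n, (D.mult P n : ℝ) *
        (D.cost β P n + A₃ * (n : ℝ) ^ 2 * Real.log ((n : ℝ) + 2)) :=
    Finset.sum_le_sum_of_subset_of_nonneg hsub fun P _ _ => hMnn P
  have hsplit : ∑ P ∈ D.alive n, (D.mult P n : ℝ) *
        (D.cost β P n + A₃ * (n : ℝ) ^ 2 * Real.log ((n : ℝ) + 2)) =
      (∑ P ∈ D.alive n, (D.mult P n : ℝ) * D.cost β P n) +
        A₃ * (n : ℝ) ^ 2 * Real.log ((n : ℝ) + 2) * ∑ P ∈ D.alive n, (D.mult P n : ℝ) := by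
    rw [Finset.mul_sum, ← Finset.sum_add_distrib]
    refine Finset.sum_congr rfl fun P _ => ?_
    ring
  have h1 := D.sum_mult_cost_le hB hn₀
  have h2 := D.sum_mult_le_level hW hB hn₀
  have h3 := mul_le_mul_of_nonneg_left h2 hE
  linarith [hsum, himg, htot, hsplit, h1, h3]

end SoloServiceData

end Summit.Schanuel.Schanuel.Theorems
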